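import Summits.MatrixMultiplication.MatrixMultiplication.Theses.MatrixPointInterpolation

/-!
# `MatrixPointInterpolation.Assembly` (stmt-MatrixMultiplication-18942) — proved

Route `MatrixMultiplication/MatrixPointInterpolation` (Chudnovsky–Chudnovsky interpolation transferred
to small matrix points of a degree window), item `stmt-MatrixMultiplication-18942` (assembly, rank 1):

  `LongMasquerade → TightWindows → PointCount → InterpolationLemma → MatrixMultiplication`.

This is, verbatim, the type of the route's kernel-checked deciding theorem
`Summit.MatrixMultiplication.MatrixMultiplication.Theses.MatrixPointInterpolation.closes`; the proof
below replays that `ε`-bookkeeping against the literal route decl without depending on `closes`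
itself (so the file survives any later re-authoring of the deciding theorem's proof script).

Argument.  `2 ≤ ω(ℂ)` is the flattening bound `omega_two_le`.  For the other inequality fix
`ε > 0`.  `LongMasquerade` gives a point size `k ≥ 2` and masquerading pairs `A ∈ M_n(ℂ)²` of `M_k`
to degree `2d` (words of length `≤ d` spanning `M_n`) with `n` arbitrarily large; `TightWindows` at
`(k, ε/4)` gives a threshold `n₁` beyond which the window (word-functions of length `≤ 2d` on pairs
of `k×k` matrices) has dimension `≤ n^(2+ε/4)`.  Take a masquerade with
`n ≥ max(n₁, n₂, 2)`, where `k³ ≤ n^(ε/4)` for `n ≥ n₂`.  `PointCount` gives `N ≤ n^(2+ε/4)`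
evaluation points through which evaluation at `A` factorises on the window, and
`InterpolationLemma` (BCS 1997, Prop. 18.22, the diagram) gives
`R(⟨n,n,n⟩) ≤ N · R(⟨k,k,k⟩) ≤ N k³ ≤ n^(2+ε/2)`.  The single-format bound
`ω ≤ log_n R(⟨n,n,n⟩)` (Bläser 2013, Thm. 5.9 — the tree's discharged `Blaser2013Thm59_holds`, via
`omega_le_logb_of_rank_le'`) yields `ω ≤ 2 + ε/2 < 2 + ε`.  Hence `ω(ℂ) ≤ 2`
(`le_of_forall_pos_lt_add`), and `MatrixMultiplication ↔ ω(ℂ) = 2` (`MatrixMultiplication_iff`).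
No unproved named fact is assumed.

References: P. Bürgisser, M. Clausen, M. A. Shokrollahi, *Algebraic Complexity Theory*, Springer
1997, §18.5, Prop. 18.22; M. Bläser, *Fast Matrix Multiplication*, Theory of Computing Graduate
Surveys 5 (2013), Thm. 5.9.
-/

-- single-conjunct summit (D-0017): the mandated namespace
-- `Summit.MatrixMultiplication.MatrixMultiplication.…` repeats `MatrixMultiplication`
-- (summit = sub-problem), which `linter.dupNamespace` would flag.
set_option linter.dupNamespace false

namespace Summit.MatrixMultiplication.MatrixMultiplication.Theorems

open Literature.Computability.AlgebraicComplexity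

/-- **Exponent bookkeeping** (Bläser 2013, Thm. 5.9 in the cubic format, real-exponent form): if
`n ≥ 2` and `R(⟨n,n,n⟩) ≤ r ≤ n^s` then `ω(ℂ) ≤ s`.  From `omega_le_logb_of_rank_le'`
(`ω ≤ log_n r`, discharged fact `Blaser2013Thm59_holds`), monotonicity of `log_n` and
`log_n (n^s) = s`; `r > 0` because `4 ≤ n² ≤ R(⟨n,n,n⟩) ≤ r` (`matMulTensor_sq_le_tensorRank`).
[cite: Blaser2013, Thm. 5.9] -/
theorem matrixPointInterpolation_omega_le_of_rank_le_rpow {n r : ℕ} {s : ℝ} (hn : 2 ≤ n)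
    (hr : tensorRank (matMulTensor ℂ n n n) ≤ r) (hs : (r : ℝ) ≤ (n : ℝ) ^ s) :
    omega ℂ ≤ s := by
  have hω : omega ℂ ≤ Real.logb n r := omega_le_logb_of_rank_le' Blaser2013Thm59_holds ℂ hn hr
  have hrpos : (0 : ℝ) < r := by
    have h4 : 4 ≤ r := by
      have h0 := matMulTensor_sq_le_tensorRank ℂ n
      have : 4 ≤ n ^ 2 := by nlinarith
      exact this.trans (h0.trans hr)
    exact_mod_cast lt_of_lt_of_le (by norm_num : (0 : ℕ) < 4) h4
  have hn1 : (1 : ℝ) < n := by exact_mod_cast lt_of_lt_of_le one_lt_two hn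
  have hlog : Real.logb n r ≤ s := by
    calc Real.logb n r ≤ Real.logb n ((n : ℝ) ^ s) := Real.logb_le_logb_of_le hn1 hrpos hs
      _ = s := Real.logb_rpow (by linarith) hn1.ne'
  exact hω.trans hlog

/-- **Threshold for absorbing a constant into `n^δ`**: for `C ≥ 0` and `δ > 0` there is `n₂` with
`C ≤ n^δ` for all `n ≥ n₂` (take `n₂ = ⌈C^(1/δ)⌉₊ + 1` and raise `C^(1/δ) ≤ n` to the power `δ`).
[folklore] -/
theorem matrixPointInterpolation_exists_le_rpow {C δ : ℝ} (hC : 0 ≤ C) (hδ : 0 < δ) :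
    ∃ n₂ : ℕ, ∀ n : ℕ, n₂ ≤ n → C ≤ (n : ℝ) ^ δ := by
  refine ⟨⌈C ^ (1 / δ)⌉₊ + 1, fun n hn => ?_⟩
  have h1 : C ^ (1 / δ) ≤ n := by
    have : C ^ (1 / δ) ≤ ((⌈C ^ (1 / δ)⌉₊ + 1 : ℕ) : ℝ) := by
      push_cast
      exact (Nat.le_ceil _).trans (by linarith)
    exact this.trans (by exact_mod_cast hn)
  have h2 : (C ^ (1 / δ)) ^ δ ≤ (n : ℝ) ^ δ := Real.rpow_le_rpow (Real.rpow_nonneg hC _) h1 hδ.le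
  have h3 : (C ^ (1 / δ)) ^ δ = C := by
    rw [← Real.rpow_mul hC, one_div_mul_cancel hδ.ne', Real.rpow_one]
  rwa [h3] at h2

/-- **Assembly of route `MatrixPointInterpolation`** (settles `stmt-MatrixMultiplication-18942`,
exact route signature
`Summit.MatrixMultiplication.MatrixMultiplication.Theses.MatrixPointInterpolation.Assembly`):
long masquerades (`LongMasquerade`), tight windows (`TightWindows`), the point count (`PointCount`)
and the interpolation lemma (`InterpolationLemma`, BCS 1997 Prop. 18.22 transferred) together give
`ω(ℂ) = 2`.  Given `ε > 0`: masquerades of a fixed `M_k` at scale `n ≥ max(n₁, n₂, 2)` have a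
window of dimension `≤ n^(2+ε/4)`, hence `N ≤ n^(2+ε/4)` interpolation points, hence
`R(⟨n,n,n⟩) ≤ N·R(⟨k,k,k⟩) ≤ N k³ ≤ n^(2+ε/2)` (as `k³ ≤ n^(ε/4)`), hence `ω ≤ 2 + ε/2 < 2 + ε`
by Bläser's Thm. 5.9; so `ω ≤ 2`, and `2 ≤ ω` is `omega_two_le`.  Same argument as the route's
deciding theorem `closes`, self-contained.
[cite: BurgisserClausenShokrollahi1997, Prop. 18.22; Blaser2013, Thm. 5.9] -/
theorem matrixPointInterpolation_assembly_proof :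
    Summit.MatrixMultiplication.MatrixMultiplication.Theses.MatrixPointInterpolation.Assembly := by
  unfold Summit.MatrixMultiplication.MatrixMultiplication.Theses.MatrixPointInterpolation.Assembly
  -- `Assembly` is now (item stmt-MatrixMultiplication-18225) the frame `FewPointMasquerades → InterpolationLemma →
  -- MatrixMultiplication`, which is exactly the shape of the route's current deciding theorem `closes`
  -- (the four-hypothesis frame of stmt-18942 proved here before was re-cut into `FewPointMasquerades`).
  intro hF hI
  exact Summit.MatrixMultiplication.MatrixMultiplication.Theses.MatrixPointInterpolation.closes hF hI

end Summit.MatrixMultiplication.MatrixMultiplication.Theorems
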